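import Literature.NumberTheory.EllipticCurves.PeriodIndexRationalDivisor
import Literature.NumberTheory.EllipticCurves.WeilPairingProofs
import Mathlib.Topology.Algebra.ClopenNhdofOne
import HarnessLib

/-!
# The period–index obstruction of a genus-one torsor, in divisor language

`Proofs`-style file (theorems only; no definitions, no named facts) under the provefact seat on
`Literature.NumberTheory.EllipticCurves.Cassels1962_index_eq_period_of_mem_sha` (`PeriodIndex`;
Cassels 1962: `I = P` on `Ш`), continuing `PeriodIndexCassels` and `PeriodIndexRationalDivisor`.
The latter reduced Cassels' theorem to: *every Selmer torsor of prime-power level `n` carries a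
`K`-rational divisor of degree `n`* (`Cassels1962_index_eq_period_of_mem_sha_of_exists_rationalDivisor`).
Both printed proofs (Cassels IV; Clark 2006, Prop. 6, twice) produce that divisor from the
**period–index obstruction**: a class `η` with `n η = 0` has a *rational divisor class* of degree
`n` on its torsor `C`, whose obstruction to containing a rational divisor is a class
`Δ ∈ Br(K)[n]` (O'Neil's `Δ`, Clark–Sharif §2 (3); the connecting map
`δ : Pic(C_{K̄})^{Γ_K} → Br(K) = H²(K, K̄^×)` of `0 → Pic(C) → Pic(C_{K̄})^{Γ_K} → Br(K)` in the
second proof of Clark 2006, Prop. 6); for `η` locally trivial `Δ` is locally trivial, hence `0`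
by the reciprocity law for `Br(K)`, and the rational divisor exists.

This file formalizes that obstruction theory on the model `C(K̄) = E(K̄)` with the twisted
action `σ ⋆ Q = σ Q + c(σ)` of a continuous cocycle `c : Γ_K → E(K̄)` (as in
`PeriodIndexRationalDivisor`) and `K̄(C) = K̄(E)` with the **twisted semilinear action**
`ρ_σ = τ_{-c(σ)}^* ∘ σ̃` (`σ̃` = `WeierstrassCurve.galFunctionField σ`, the action through the
coefficients, `WeilPairingProofs` §1; `τ_T^*` = `WeierstrassCurve.transAlgHom T`, translation,
`FunctionFieldTranslation`), on top of the tree's divisor theory of `K̄(E)` (`WeierstrassPlaces`: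
`ord`, `finsum_ord`; `WeilPairingDivisors`: `exists_ord_eq` = Silverman Cor. III.3.5,
`exists_eq_algebraMap_of_ord_nonneg`, `ord_transAlgHom`; `ord_galFunctionField`,
`galFunctionField_transAlgHom`). Everything is proved; the one remaining input of Cassels'
theorem is isolated as the hypothesis of the last theorem.

* `index_dvd_degree_of_twistInvariant` — a twisted-invariant `ℤ`-divisor `D` gives `I([c]) ∣ deg D`
  (positive/negative parts + `index_dvd_card_of_twistInvariant`).
* `galFunctionField_one/_mul` — `σ ↦ σ̃` is an action; `twistGal_algebraMap/_one/_mul`,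
  `ord_twistGal` (`ord_{σ⋆P}(ρ_σ u) = ord_P u`): `ρ` is a semilinear action moving divisors by `⋆`.
* `exists_eq_twistGal_div` — **Hilbert 90 for the twisted action** (`K` perfect): a locally
  constant `f : Γ_K → K̄(E)^×` with `f(στ) = f(σ) ρ_σ(f(τ))` is `ρ_σ(g)/g` (open normal subgroup
  where `f = 1`, `c = 0`; Dedekind independence `linearIndependent_monoidHom` over the
  `N`-invariants; faithfulness from Krull's `InfiniteGalois.fixingSubgroup_fixedField`).
* `exists_zsmul_twist_sub_eq_zero` — `n[c] = 0` gives `T` with `n(σ⋆T - T) = O` (the rational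
  divisor class `n·(T)` of degree `n`); `exists_fn_ord_eq_twist` — locally constant `f_σ` with
  `div f_σ = n(σ⋆T) - n(T)`; `exists_obstruction_eq_algebraMap` — `e(σ,τ) = f_σ ρ_σ(f_τ)/f_{στ}`
  is a non-zero constant (the obstruction `2`-cocycle with values in `K̄^×`).
* `exists_twistInvariant_divisor_of_coboundary`, `index_dvd_of_obstruction_coboundary` — **if
  `e = ∂b` for a locally constant `b : Γ_K → K̄^×` then the torsor has a rational divisor of
  degree `n` and `I([c]) ∣ n`** (`f_σ/b(σ)` is a `1`-cocycle, `= ρ_σ(g)/g` by Hilbert 90, and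
  `n(T) - div g` is invariant).
* `Cassels1962_index_eq_period_of_mem_sha_of_obstruction` — **Cassels' `I = P` on `Ш` follows
  from the vanishing (as a continuous coboundary) of the obstruction cocycle of every Selmer
  class at prime-power level** — the statement supplied in print by local triviality plus the
  Albert–Brauer–Hasse–Noether exact sequence `0 → Br(K) → ⊕_v Br(K_v)`.

## References

* P. L. Clark, *There are genus one curves of every index over every number field*, J. reine
  angew. Math. 594 (2006) 201–206, Prop. 6 (both proofs) and Prop. 5(a); arXiv:math/0411413 read.
  [Clark2006Crelle]
* P. L. Clark, S. Sharif, *Period, index and potential Ш*, Algebra & Number Theory 4 (2010)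
  151–174, §1.1, §1.3, §2 eq. (3), §3.7 (ii); arXiv:0811.3019. [ClarkSharif2010]
* J. W. S. Cassels, *Arithmetic on curves of genus 1. IV. Proof of the Hauptvermutung*, J. reine
  angew. Math. 211 (1962) 95–112 (the theorem `I = P` on `Ш`, as reported by the two sources above).
* J. H. Silverman, *The Arithmetic of Elliptic Curves*, 2nd ed., GTM 106: II.§1–3, Cor. III.3.5,
  X.§2–3 (twisting, torsors). [SilvermanAEC2009]
* J.-P. Serre, *Local Fields*, X.§1 Prop. 2 (Hilbert 90); *Galois Cohomology*, I.§2.2, II.§1.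

## Design

`noncomputable section`, `open scoped Classical`, one universe `u`. No definition is introduced:
the twisted action on functions is written out as `W.transAlgHom (-(c.1 σ)) (W.galFunctionField σ z)`
and divisors are `E(K̄) →₀ ℤ`; the obstruction is handled through explicit functions
`f : Γ_K → K̄(E)`, `b : Γ_K → K̄` with `IsLocallyConstant` (= continuity for the discrete
topology), so that no model of `H²` is fixed here.
-/

noncomputable section

open scoped Classical

universe u

namespace Literature.NumberTheory.EllipticCurves

open GaloisRepresentations WeierstrassCurve WeierstrassFunctionField

/-! ### `ℤ`-divisors invariant under the twisted action bound the index -/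

section ZDivisor

variable {K : Type u} [Field K] [PerfectField K] (W : WeierstrassCurve K)
variable (c : contOneCocycles (discreteTopRep (Field.absoluteGaloisGroup K) (WeierstrassCurve.geomPoints W)))

/-- **A rational divisor on the torsor bounds the index** (`ℤ`-divisors). Let `c : Γ_K → E(K̄)` be
a continuous crossed homomorphism over a perfect field `K` and `D : E(K̄) →₀ ℤ` a divisor on
`E_{K̄}` invariant under the twisted action `σ ⋆ Q = σ Q + c(σ)` (a `K`-rational divisor on the
torsor `C_c`). Then `I([c]) ∣ deg D`: the effective divisors `D⁺`, `D⁻` (positive and negative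
parts) are separately invariant, and `I([c])` divides `deg D⁺` and `deg D⁻`
(`Literature.NumberTheory.EllipticCurves.index_dvd_card_of_twistInvariant`). Clark–Sharif §1.1:
"In terms of `(C, ι)`, the index is the least degree of a `K`-rational divisor" (direction
`I ∣ deg D`). [cite: ClarkSharif2010, §1.1] [cite: Clark2006Crelle, Prop. 6] -/
theorem index_dvd_degree_of_twistInvariant (D : WeierstrassCurve.geomPoints W →₀ ℤ)
    (hD : ∀ (g : Field.absoluteGaloisGroup K) (Q : WeierstrassCurve.geomPoints W),
      D (g • Q + c.1 g) = D Q) :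
    (index W (oneCocycleClass _ c) : ℤ) ∣ D.sum fun _ n ↦ n := by
  -- positive and negative parts of `D`, as multisets of points
  let Dp : WeierstrassCurve.geomPoints W →₀ ℕ := D.mapRange Int.toNat (by simp)
  let Dm : WeierstrassCurve.geomPoints W →₀ ℕ := D.mapRange (fun n ↦ (-n).toNat) (by simp)
  have hp : (index W (oneCocycleClass _ c) : ℤ) ∣ (Multiset.card (Finsupp.toMultiset Dp) : ℤ) := by
    exact_mod_cast index_dvd_card_of_twistInvariant W (Finsupp.toMultiset Dp) fun g Q ↦ by
      rw [Finsupp.count_toMultiset, Finsupp.count_toMultiset]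
      simp only [Dp, Finsupp.mapRange_apply, hD]
  have hm : (index W (oneCocycleClass _ c) : ℤ) ∣ (Multiset.card (Finsupp.toMultiset Dm) : ℤ) := by
    exact_mod_cast index_dvd_card_of_twistInvariant W (Finsupp.toMultiset Dm) fun g Q ↦ by
      rw [Finsupp.count_toMultiset, Finsupp.count_toMultiset]
      simp only [Dm, Finsupp.mapRange_apply, hD]
  have hsum : (D.sum fun _ n ↦ n) =
      (Multiset.card (Finsupp.toMultiset Dp) : ℤ) - Multiset.card (Finsupp.toMultiset Dm) := by
    rw [Finsupp.card_toMultiset, Finsupp.card_toMultiset]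
    simp only [Dp, Dm]
    rw [Finsupp.sum_mapRange_index (fun _ ↦ rfl), Finsupp.sum_mapRange_index (fun _ ↦ rfl)]
    simp only [Finsupp.sum, id_eq, Nat.cast_sum, ← Finset.sum_sub_distrib, Int.toNat_sub_toNat_neg]
  rw [hsum]
  exact dvd_sub hp hm

end ZDivisor

/-! ### The action of `Γ_K` on `K̄(E)` is an action -/

section GalAction

variable {K : Type u} [Field K] (W : WeierstrassCurve K)

/-- `galRingHom 1 = id`. [folklore] -/
theorem galRingHom_one : galRingHom (K := K) 1 = RingHom.id _ :=
  RingHom.ext fun x ↦ (galRingHom_apply 1 x).trans (one_smul _ x)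

/-- `galRingHom (σ τ) = galRingHom σ ∘ galRingHom τ`. [folklore] -/
theorem galRingHom_mul (σ τ : Field.absoluteGaloisGroup K) :
    galRingHom (σ * τ) = (galRingHom σ).comp (galRingHom τ) :=
  RingHom.ext fun x ↦ galRingHom_mul_apply σ τ x

/-- The trivial element acts trivially on `K̄[E]`. [folklore] -/
theorem galCoordRing_one (r : W.geomCoordRing) : W.galCoordRing 1 r = r := by
  obtain ⟨p, rfl⟩ := AdjoinRoot.mk_surjective r
  rw [galCoordRing_mk, galRingHom_one, Polynomial.mapRingHom_id, Polynomial.map_id]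

/-- The action on `K̄[E]` is multiplicative in `σ`. [folklore] -/
theorem galCoordRing_mul (σ τ : Field.absoluteGaloisGroup K) (r : W.geomCoordRing) :
    W.galCoordRing (σ * τ) r = W.galCoordRing σ (W.galCoordRing τ r) := by
  obtain ⟨p, rfl⟩ := AdjoinRoot.mk_surjective r
  rw [galCoordRing_mk, galCoordRing_mk, galCoordRing_mk, Polynomial.map_map, Polynomial.mapRingHom_comp,
    ← galRingHom_mul]

/-- **The trivial element of `Γ_K` acts trivially on `K̄(E)`.** [folklore] -/
theorem galFunctionField_one (z : W.geomFunctionField) : W.galFunctionField 1 z = z := by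
  have h : (W.galFunctionField 1).toRingHom = RingHom.id _ := by
    refine IsLocalization.ringHom_ext (nonZeroDivisors W.geomCoordRing) (RingHom.ext fun r ↦ ?_)
    change W.galFunctionField 1 (algebraMap W.geomCoordRing W.geomFunctionField r) =
      algebraMap W.geomCoordRing W.geomFunctionField r
    rw [galFunctionField_algebraMap, galCoordRing_one]
  exact RingHom.congr_fun h z

/-- **The action of `Γ_K` on `K̄(E)` is multiplicative**: `(σ τ)~ = σ̃ ∘ τ̃` (both are the
extensions to the fraction field of the same automorphism of `K̄[E]`). Silverman, *AEC*, I.§1–2,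
II.§2. [folklore] -/
theorem galFunctionField_mul (σ τ : Field.absoluteGaloisGroup K) (z : W.geomFunctionField) :
    W.galFunctionField (σ * τ) z = W.galFunctionField σ (W.galFunctionField τ z) := by
  have h : (W.galFunctionField (σ * τ)).toRingHom =
      (W.galFunctionField σ).toRingHom.comp (W.galFunctionField τ).toRingHom := by
    refine IsLocalization.ringHom_ext (nonZeroDivisors W.geomCoordRing) (RingHom.ext fun r ↦ ?_)
    change W.galFunctionField (σ * τ) (algebraMap W.geomCoordRing W.geomFunctionField r) =
      W.galFunctionField σ (W.galFunctionField τ (algebraMap W.geomCoordRing W.geomFunctionField r))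
    rw [galFunctionField_algebraMap, galFunctionField_algebraMap, galFunctionField_algebraMap,
      galCoordRing_mul]
  exact RingHom.congr_fun h z

variable [W.IsElliptic]

/-- `τ_S^* (τ_T^* w) = τ_{S+T}^* w` (`transAlgHom_add`, pointwise). [folklore] -/
theorem transAlgHom_transAlgHom (S T : WeierstrassCurve.geomPoints W) (w : W.geomFunctionField) :
    W.transAlgHom S (W.transAlgHom T w) = W.transAlgHom (S + T) w := by
  rw [transAlgHom_add, AlgHom.comp_apply]

end GalAction

/-! ### The twisted action `ρ_σ = τ_{-c(σ)}^* ∘ σ̃` of a cocycle on `K̄(E)` -/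

section TwistedAction

variable {K : Type u} [Field K] (W : WeierstrassCurve K) [W.IsElliptic]
variable (c : contOneCocycles (discreteTopRep (Field.absoluteGaloisGroup K) (WeierstrassCurve.geomPoints W)))

/-- **The twisted action acts on the constants `K̄ ⊆ K̄(E)` as `Γ_K` does**:
`ρ_σ(x) = σ x` (`τ^*` is `K̄`-linear and `σ̃` acts on constants as `σ`). [folklore] -/
theorem twistGal_algebraMap (σ : Field.absoluteGaloisGroup K) (x : AlgebraicClosure K) :
    W.transAlgHom (-(c.1 σ)) (W.galFunctionField σ
      (algebraMap (AlgebraicClosure K) W.geomFunctionField x)) =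
      algebraMap (AlgebraicClosure K) W.geomFunctionField (σ • x) := by
  rw [galFunctionField_algebraMap_base, AlgHom.commutes, galRingHom_apply]

/-- `ρ_1 = id` (`c(1) = 0`, `τ_0^* = id`, `1̃ = id`). [folklore] -/
theorem twistGal_one (z : W.geomFunctionField) :
    W.transAlgHom (-(c.1 1)) (W.galFunctionField 1 z) = z := by
  rw [contOneCocycles.apply_one, neg_zero, transAlgHom_zero, AlgHom.coe_id, id_eq,
    galFunctionField_one]

/-- **The twisted action is an action: `ρ_{στ} = ρ_σ ∘ ρ_τ`** — the cocycle identity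
`c(στ) = c(σ) + σ c(τ)` together with `σ̃ ∘ τ_T^* = τ_{σT}^* ∘ σ̃`
(`WeierstrassCurve.galFunctionField_transAlgHom`) and `τ_S^* τ_T^* = τ_{S+T}^*`. This is the
semilinear action of `Γ_K` on `K̄(C) = K̄(E)` defining the function field `K(C) = K̄(E)^{ρ}` of the
torsor `C = C_c` (Silverman, *AEC*, X.§2, twisting; Clark–Sharif §2). [folklore] -/
theorem twistGal_mul (σ τ : Field.absoluteGaloisGroup K) (z : W.geomFunctionField) :
    W.transAlgHom (-(c.1 (σ * τ))) (W.galFunctionField (σ * τ) z) =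
      W.transAlgHom (-(c.1 σ)) (W.galFunctionField σ
        (W.transAlgHom (-(c.1 τ)) (W.galFunctionField τ z))) := by
  rw [galFunctionField_transAlgHom σ (-(c.1 τ)), transAlgHom_transAlgHom, ← galFunctionField_mul,
    c.2 σ τ, discreteTopRep_ρ_apply, neg_add, smul_neg]

/-- **`ord_{σ ⋆ P} (ρ_σ u) = ord_P (u)`**: the twisted action on functions moves divisors by the
twisted action `σ ⋆ P = σ P + c(σ)` on points (`ord_P (τ_T^* u) = ord_{P+T} (u)` and
`ord_{σP} (σ̃ u) = ord_P (u)`). [folklore] -/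
theorem ord_twistGal (σ : Field.absoluteGaloisGroup K) (P : WeierstrassCurve.geomPoints W)
    (u : W.geomFunctionField) :
    ord (W.baseChange (AlgebraicClosure K)).toAffine (σ • P + c.1 σ)
      (W.transAlgHom (-(c.1 σ)) (W.galFunctionField σ u)) =
      ord (W.baseChange (AlgebraicClosure K)).toAffine P u := by
  rw [ord_transAlgHom, add_neg_cancel_right, ord_galFunctionField]

/-- `ord_Q (ρ_σ u) = ord_{σ⁻¹ ⋆ Q} (u)` with `σ⁻¹ ⋆ Q = σ⁻¹ (Q - c(σ))` (`ord_twistGal` at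
`P = σ⁻¹ ⋆ Q`). [folklore] -/
theorem ord_twistGal' (σ : Field.absoluteGaloisGroup K) (Q : WeierstrassCurve.geomPoints W)
    (u : W.geomFunctionField) :
    ord (W.baseChange (AlgebraicClosure K)).toAffine Q
      (W.transAlgHom (-(c.1 σ)) (W.galFunctionField σ u)) =
      ord (W.baseChange (AlgebraicClosure K)).toAffine (σ⁻¹ • (Q - c.1 σ)) u := by
  conv_lhs => rw [show Q = σ • (σ⁻¹ • (Q - c.1 σ)) + c.1 σ by rw [smul_inv_smul, sub_add_cancel]]
  exact ord_twistGal W c σ _ u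

/-- The twisted action of `σ` is injective on `K̄(E)` (it is a ring automorphism). [folklore] -/
theorem twistGal_injective (σ : Field.absoluteGaloisGroup K) :
    Function.Injective fun z : W.geomFunctionField ↦
      W.transAlgHom (-(c.1 σ)) (W.galFunctionField σ z) :=
  (W.transAlgHom (-(c.1 σ))).toRingHom.injective.comp (W.galFunctionField σ).injective

end TwistedAction

/-! ### Hilbert's Theorem 90 for the function field of the torsor -/

section Hilbert90

variable {K : Type u} [Field K] [PerfectField K] (W : WeierstrassCurve K) [W.IsElliptic]
variable (c : contOneCocycles (discreteTopRep (Field.absoluteGaloisGroup K) (WeierstrassCurve.geomPoints W)))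

/-- **Hilbert's Theorem 90 for the twisted action** (`H¹(K, K̄(C)^×) = 0` for the torsor
`C = C_c`, `K` perfect). Let `f : Γ_K → K̄(E)^×` be locally constant with
`f(στ) = f(σ) · ρ_σ(f(τ))` for the twisted action `ρ_σ = τ_{-c(σ)}^* ∘ σ̃`. Then
`f(σ) = ρ_σ(g) / g` for some `g ∈ K̄(E)^×`. Proof: `f = 1` and `c = 0` on an open normal subgroup
`N` (so `f` factors through the finite group `G = Γ_K/N` and takes `N`-invariant values); for the
distinct characters `ρ_s : (K̄(E)^N)^× → K̄(E)` (`s` running over coset representatives; they are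
distinct already on the constants `K̄^N`, `N` being closed: Krull's correspondence
`InfiniteGalois.fixingSubgroup_fixedField`) Dedekind's independence
(`linearIndependent_monoidHom`) provides `z` with `β = Σ_s f(s) ρ_s(z) ≠ 0`, and
`ρ_σ(β) = f(σ)⁻¹ β`, so `g = β⁻¹` works (the proof of Hilbert 90, Serre, *Local Fields*, X.§1,
Prop. 2, run for the semilinear action `ρ`). Silverman, *AEC*, X.§2 (twists) and II.§2;
Serre, *Galois Cohomology*, II.§1.2 and III.§1. [folklore] -/
theorem exists_eq_twistGal_div
    (f : Field.absoluteGaloisGroup K → W.geomFunctionField) (hfc : IsLocallyConstant f)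
    (hf0 : ∀ σ, f σ ≠ 0)
    (hf : ∀ σ τ, f (σ * τ) = f σ * W.transAlgHom (-(c.1 σ)) (W.galFunctionField σ (f τ))) :
    ∃ g : W.geomFunctionField, g ≠ 0 ∧
      ∀ σ, f σ = W.transAlgHom (-(c.1 σ)) (W.galFunctionField σ g) / g := by
  -- the twisted action as ring endomorphisms `ρ σ`
  set ρ : Field.absoluteGaloisGroup K → W.geomFunctionField →+* W.geomFunctionField :=
    fun σ ↦ (W.transAlgHom (-(c.1 σ))).toRingHom.comp (W.galFunctionField σ).toRingHom with hρ
  have hρapply : ∀ σ z, ρ σ z = W.transAlgHom (-(c.1 σ)) (W.galFunctionField σ z) :=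
    fun _ _ ↦ rfl
  have hρmul : ∀ σ τ z, ρ (σ * τ) z = ρ σ (ρ τ z) := fun σ τ z ↦ twistGal_mul W c σ τ z
  have hρone : ∀ z, ρ 1 z = z := fun z ↦ twistGal_one W c z
  have hρconst : ∀ (σ : Field.absoluteGaloisGroup K) (x : AlgebraicClosure K),
      ρ σ (algebraMap (AlgebraicClosure K) W.geomFunctionField x) =
        algebraMap (AlgebraicClosure K) W.geomFunctionField (σ • x) :=
    fun σ x ↦ twistGal_algebraMap W c σ x
  have hf' : ∀ σ τ, f (σ * τ) = f σ * ρ σ (f τ) := hf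
  -- `f 1 = 1`
  have hf1 : f 1 = 1 := by
    have h := hf' 1 1
    rw [mul_one, hρone] at h
    exact mul_right_cancel₀ (hf0 1) (h.symm.trans (one_mul (f 1)).symm)
  -- the open subgroup `V = {f = 1} ∩ {c = 0}`
  let V : Subgroup (Field.absoluteGaloisGroup K) :=
    { carrier := {σ | f σ = 1 ∧ c.1 σ = 0}
      mul_mem' := fun {σ τ} hσ hτ ↦ by
        refine ⟨?_, ?_⟩
        · rw [hf', hσ.1, hτ.1, map_one, one_mul]
        · rw [c.2 σ τ, discreteTopRep_ρ_apply, hσ.2, hτ.2, smul_zero, add_zero]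
      one_mem' := ⟨hf1, contOneCocycles.apply_one c⟩
      inv_mem' := fun {σ} hσ ↦ by
        refine ⟨?_, ?_⟩
        · have h := hf' σ σ⁻¹
          rw [mul_inv_cancel, hf1, hσ.1, one_mul] at h
          exact (ρ σ).injective ((map_one (ρ σ)).trans h).symm
        · have h := c.2 σ σ⁻¹
          rw [mul_inv_cancel, contOneCocycles.apply_one, discreteTopRep_ρ_apply, hσ.2,
            zero_add] at h
          exact (smul_eq_zero_iff_eq σ).mp h.symm }
  have hVmem : ∀ σ, σ ∈ V ↔ f σ = 1 ∧ c.1 σ = 0 := fun σ ↦ Iff.rfl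
  have hVopen : IsOpen (V : Set (Field.absoluteGaloisGroup K)) := by
    have hVeq : (V : Set (Field.absoluteGaloisGroup K)) =
        {σ | f σ = 1} ∩ (fun σ ↦ c.1 σ) ⁻¹' {0} := Set.ext fun σ ↦ Iff.rfl
    rw [hVeq]
    exact (hfc.isOpen_fiber 1).inter (c.1.continuous.isOpen_preimage _ (isOpen_discrete _))
  -- an open normal subgroup `N ≤ V` (`Γ_K` is compact; `K̄/K` is Galois as `K` is perfect)
  haveI : IsGalois K (AlgebraicClosure K) := {}
  haveI : CompactSpace (Field.absoluteGaloisGroup K) :=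
    inferInstanceAs (CompactSpace (AlgebraicClosure K ≃ₐ[K] AlgebraicClosure K))
  obtain ⟨N, hNV⟩ := IsTopologicalGroup.exist_openNormalSubgroup_sub_clopen_nhds_of_one
    ⟨V.isClosed_of_isOpen hVopen, hVopen⟩ V.one_mem
  set Ns : Subgroup (Field.absoluteGaloisGroup K) := N.toSubgroup with hNs
  have hNopen : IsOpen (Ns : Set (Field.absoluteGaloisGroup K)) := N.isOpen'
  have hNV' : ∀ u ∈ Ns, u ∈ V := fun u hu ↦ hNV hu
  have hNf : ∀ u ∈ Ns, f u = 1 := fun u hu ↦ ((hVmem u).mp (hNV' u hu)).1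
  haveI : Ns.Normal := N.isNormal'
  letI : Fintype (Field.absoluteGaloisGroup K ⧸ Ns) := Fintype.ofFinite _
  -- `f` factors through `Γ_K / N` and takes `N`-invariant values
  have hfN : ∀ σ, ∀ u ∈ Ns, f (σ * u) = f σ := fun σ u hu ↦ by
    rw [hf', hNf u hu, map_one, mul_one]
  have hfix : ∀ σ, ∀ u ∈ Ns, ρ u (f σ) = f σ := fun σ u hu ↦ by
    have h1 : f (u * σ) = ρ u (f σ) := by rw [hf', hNf u hu, one_mul]
    have h2 : u * σ = σ * (σ⁻¹ * u * σ) := by group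
    rw [← h1, h2, hfN σ _ (Subgroup.Normal.conj_mem' inferInstance u hu σ)]
  -- the monoid `M` of `N`-invariant functions and the characters `ρ_γ : M → K̄(E)`
  let M : Submonoid W.geomFunctionField :=
    { carrier := {z | ∀ u ∈ Ns, ρ u z = z}
      mul_mem' := fun {a b} ha hb u hu ↦ by
        change ρ u (a * b) = a * b
        rw [map_mul, ha u hu, hb u hu]
      one_mem' := fun u _ ↦ map_one (ρ u) }
  have hMmem : ∀ z, z ∈ M ↔ ∀ u ∈ Ns, ρ u z = z := fun z ↦ Iff.rfl
  have hconstM : ∀ x : AlgebraicClosure K, (∀ u ∈ Ns, u • x = x) →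
      algebraMap (AlgebraicClosure K) W.geomFunctionField x ∈ M := fun x hx u hu ↦ by
    rw [hρconst, hx u hu]
  have hρM : ∀ γ, ∀ z ∈ M, ∀ u ∈ Ns, ρ (γ * u) z = ρ γ z := fun γ z hz u hu ↦ by
    rw [hρmul, (hMmem z).mp hz u hu]
  let χ : Field.absoluteGaloisGroup K → (M →* W.geomFunctionField) :=
    fun γ ↦ (ρ γ : W.geomFunctionField →* W.geomFunctionField).comp M.subtype
  have hχ : ∀ γ (z : M), χ γ z = ρ γ z := fun _ _ ↦ rfl
  -- coset representatives
  let s : Field.absoluteGaloisGroup K ⧸ Ns → Field.absoluteGaloisGroup K := Quotient.out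
  have hs : ∀ q, (QuotientGroup.mk (s q) : Field.absoluteGaloisGroup K ⧸ Ns) = q :=
    fun q ↦ QuotientGroup.out_eq' q
  -- distinct cosets give distinct characters (they differ on the constants `K̄^N`)
  have hinj : Function.Injective fun q ↦ χ (s q) := by
    intro q₁ q₂ h
    have hfix' : ∀ x ∈ IntermediateField.fixedField Ns, ((s q₂)⁻¹ * s q₁) • x = x := by
      intro x hx
      rw [IntermediateField.mem_fixedField_iff] at hx
      have hxM : algebraMap (AlgebraicClosure K) W.geomFunctionField x ∈ M :=
        hconstM x fun u hu ↦ hx u hu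
      have h1 : χ (s q₁) ⟨_, hxM⟩ = χ (s q₂) ⟨_, hxM⟩ := by
        simp only at h
        rw [h]
      rw [hχ, hχ] at h1
      change ρ (s q₁) (algebraMap (AlgebraicClosure K) W.geomFunctionField x) =
        ρ (s q₂) (algebraMap (AlgebraicClosure K) W.geomFunctionField x) at h1
      rw [hρconst, hρconst] at h1
      have h2 : s q₁ • x = s q₂ • x :=
        (algebraMap (AlgebraicClosure K) W.geomFunctionField).injective h1
      rw [mul_smul, inv_smul_eq_iff, h2]
    have hmem : (s q₂)⁻¹ * s q₁ ∈ (IntermediateField.fixedField Ns).fixingSubgroup :=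
      (IntermediateField.mem_fixingSubgroup_iff _ _).mpr hfix'
    rw [InfiniteGalois.fixingSubgroup_fixedField ⟨Ns, Ns.isClosed_of_isOpen hNopen⟩] at hmem
    change (s q₂)⁻¹ * s q₁ ∈ Ns at hmem
    have h3 : (QuotientGroup.mk (s q₂) : Field.absoluteGaloisGroup K ⧸ Ns) = QuotientGroup.mk (s q₁) :=
      QuotientGroup.eq.mpr hmem
    rw [hs, hs] at h3
    exact h3.symm
  have hli : LinearIndependent W.geomFunctionField
      fun q : Field.absoluteGaloisGroup K ⧸ Ns ↦ (χ (s q) : M → W.geomFunctionField) :=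
    (linearIndependent_monoidHom M W.geomFunctionField).comp (fun q ↦ χ (s q)) hinj
  -- Dedekind: some `z ∈ M` has `β = Σ_q f(s_q) ρ_{s_q}(z) ≠ 0`
  obtain ⟨z, hz⟩ : ∃ z : M, ∑ q : Field.absoluteGaloisGroup K ⧸ Ns, f (s q) * ρ (s q) z ≠ 0 := by
    by_contra hzero
    push Not at hzero
    have hrel : ∑ q : Field.absoluteGaloisGroup K ⧸ Ns,
        f (s q) • (χ (s q) : M → W.geomFunctionField) = 0 := by
      funext w
      simp only [Finset.sum_apply, Pi.smul_apply, smul_eq_mul, Pi.zero_apply, hχ]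
      exact hzero w
    exact hf0 _ (Fintype.linearIndependent_iff.mp hli (fun q ↦ f (s q)) hrel (QuotientGroup.mk 1))
  set β : W.geomFunctionField := ∑ q : Field.absoluteGaloisGroup K ⧸ Ns, f (s q) * ρ (s q) z
    with hβ
  -- `ρ_σ(β) = f(σ)⁻¹ β`
  have hρβ : ∀ σ, ρ σ β = (f σ)⁻¹ * β := by
    intro σ
    rw [hβ, map_sum, Finset.mul_sum, ← Equiv.sum_comp (Equiv.mulLeft
      (QuotientGroup.mk σ : Field.absoluteGaloisGroup K ⧸ Ns))
      (fun q ↦ (f σ)⁻¹ * (f (s q) * ρ (s q) z))]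
    refine Finset.sum_congr rfl fun q _ ↦ ?_
    obtain ⟨u, hu⟩ := QuotientGroup.mk_out_eq_mul Ns (σ * s q)
    have hsq : s (QuotientGroup.mk σ * q) = σ * s q * u := by
      rw [← hu, QuotientGroup.mk_mul, hs]
    have hσsq : σ * s q = s (QuotientGroup.mk σ * q) * (u : Field.absoluteGaloisGroup K)⁻¹ := by
      rw [hsq, mul_inv_cancel_right]
    have hfs : ρ σ (f (s q)) = (f σ)⁻¹ * f (σ * s q) := by
      rw [hf' σ (s q), inv_mul_cancel_left₀ (hf0 σ)]
    simp only [Equiv.coe_mulLeft]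
    rw [map_mul, ← hρmul, hfs, hσsq, hfN _ _ (Ns.inv_mem u.2), hρM _ _ z.2 _ (Ns.inv_mem u.2),
      mul_assoc]
  have hβ0 : β ≠ 0 := hz
  refine ⟨β⁻¹, inv_ne_zero hβ0, fun σ ↦ ?_⟩
  rw [← hρapply, map_inv₀, hρβ, mul_inv_rev, inv_inv, mul_comm, mul_div_cancel_right₀ _
    (inv_ne_zero hβ0)]

end Hilbert90

/-! ### The obstruction: a rational divisor class of degree `n` and its `2`-cocycle -/

section Obstruction

variable {K : Type u} [Field K] (W : WeierstrassCurve K) [W.IsElliptic]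
variable (c : contOneCocycles (discreteTopRep (Field.absoluteGaloisGroup K) (WeierstrassCurve.geomPoints W)))

/-- **A class killed by `n` has a point `T` whose twisted orbit lies in `T + E[n]`**, i.e. a
divisor class `n·(T)` of degree `n` on the torsor invariant under the twisted action: if
`n · [c] = 0` in `H¹(K, E)` then `n c(σ) = σ v - v` for some `v ∈ E(K̄)`
(`GaloisRepresentations.oneCocycleClass_eq_zero_iff`), and any `T` with `n T = -v` (`[n]` is onto
`E(K̄)`, `WeierstrassCurve.zsmul_geomPoints_surjective_holds`) has `n (σ T + c(σ) - T) = 0` for all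
`σ`. This is the rational divisor class of degree `P` of a class of period `P`: "a rational
divisor class on `C`" (Clark 2006, Prop. 6); `Pic^n(C)` is the trivial torsor when `n η = 0`.
[cite: Clark2006Crelle, Prop. 6] -/
theorem exists_zsmul_twist_sub_eq_zero {n : ℤ} (hn : n ≠ 0) (hc : n • oneCocycleClass _ c = 0) :
    ∃ T : WeierstrassCurve.geomPoints W, ∀ σ : Field.absoluteGaloisGroup K,
      n • (σ • T + c.1 σ - T) = 0 := by
  have hc' : oneCocycleClass _ (n • c) = 0 := by
    rw [oneCocycleClass_smul]
    rw [← int_smul_eq_zsmul (ModuleCat.isModule _)] at hc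
    exact hc
  rw [oneCocycleClass_eq_zero_iff] at hc'
  obtain ⟨v, hv⟩ := hc'
  obtain ⟨T, hT⟩ := WeierstrassCurve.zsmul_geomPoints_surjective_holds W hn (-v)
  refine ⟨T, fun σ ↦ ?_⟩
  have hσ : n • c.1 σ = σ • v - v := by
    have h := hv σ
    rw [Submodule.coe_smul, ContinuousMap.smul_apply, discreteTopRep_ρ_apply] at h
    exact h
  have hT' : n • T = -v := hT
  rw [smul_sub, smul_add, smul_comm n σ T, hT', hσ, smul_neg]
  abel

/-- **The functions `f_σ` with `div f_σ = n(σ ⋆ T) - n(T)`.** For `T` as in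
`exists_zsmul_twist_sub_eq_zero`, the divisor `n(σ ⋆ T) - n(T)` (`σ ⋆ T = σ T + c(σ)`) has degree
`0` and sum `n(σ ⋆ T - T) = O`, so it is principal (Silverman, *AEC*, Cor. III.3.5:
`Literature.NumberTheory.EllipticCurves.exists_ord_eq`); choosing the function as a function of
the point `σ ⋆ T` makes `σ ↦ f_σ` locally constant (`σ ↦ σ ⋆ T` is locally constant: stabilisers
are open, `WeierstrassCurve.isOpen_stabilizer_point_holds`, and `c` is continuous).
[cite: SilvermanAEC2009, Cor. III.3.5] [cite: Clark2006Crelle, Prop. 6 (second proof)] -/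
theorem exists_fn_ord_eq_twist {n : ℤ} (T : WeierstrassCurve.geomPoints W)
    (hT : ∀ σ : Field.absoluteGaloisGroup K, n • (σ • T + c.1 σ - T) = 0) :
    ∃ f : Field.absoluteGaloisGroup K → W.geomFunctionField, IsLocallyConstant f ∧
      (∀ σ, f σ ≠ 0) ∧ ∀ σ P, ord (W.baseChange (AlgebraicClosure K)).toAffine P (f σ) =
        (Finsupp.single (σ • T + c.1 σ) n - Finsupp.single T n) P := by
  -- the principal divisors `n(A) - n(T)` for `n(A - T) = 0`
  have hex : ∀ A : WeierstrassCurve.geomPoints W, n • (A - T) = 0 →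
      ∃ u : W.geomFunctionField, u ≠ 0 ∧
        ∀ P, ord (W.baseChange (AlgebraicClosure K)).toAffine P u =
          (Finsupp.single A n - Finsupp.single T n) P := by
    intro A hA
    refine exists_ord_eq (Finsupp.single A n - Finsupp.single T n) ?_ ?_
    · rw [Finsupp.sum_sub_index (fun _ _ _ ↦ rfl), Finsupp.sum_single_index rfl,
        Finsupp.sum_single_index rfl, sub_self]
    · rw [Finsupp.sum_sub_index (fun _ _ _ ↦ sub_zsmul _ _ _), Finsupp.sum_single_index (zero_zsmul _),
        Finsupp.sum_single_index (zero_zsmul _), ← smul_sub, hA]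
  choose! F hF0 hF using hex
  -- `σ ↦ σ ⋆ T` is locally constant
  have hlc : IsLocallyConstant fun σ : Field.absoluteGaloisGroup K ↦ σ • T + c.1 σ := by
    refine (IsLocallyConstant.iff_exists_open _).mpr fun σ₀ ↦ ?_
    let S : Set (Field.absoluteGaloisGroup K) :=
      (MulAction.stabilizer (Field.absoluteGaloisGroup K) T : Set (Field.absoluteGaloisGroup K)) ∩
        (fun g ↦ c.1 g) ⁻¹' {0}
    have hS : IsOpen S := (WeierstrassCurve.isOpen_stabilizer_point_holds W T).inter
      (c.1.continuous.isOpen_preimage _ (isOpen_discrete _))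
    refine ⟨(fun σ ↦ σ₀⁻¹ * σ) ⁻¹' S, hS.preimage (continuous_const.mul continuous_id), ?_, ?_⟩
    · change σ₀⁻¹ * σ₀ ∈ S
      rw [inv_mul_cancel]
      exact ⟨by simp, by simpa using contOneCocycles.apply_one c⟩
    · rintro σ ⟨h1, h2⟩
      rw [SetLike.mem_coe, MulAction.mem_stabilizer_iff] at h1
      rw [Set.mem_preimage, Set.mem_singleton_iff] at h2
      have hσ : σ = σ₀ * (σ₀⁻¹ * σ) := by group
      simp only
      rw [hσ, twist_mul, h1, h2, add_zero]
  refine ⟨fun σ ↦ F (σ • T + c.1 σ), hlc.comp F, fun σ ↦ hF0 _ (hT σ), fun σ P ↦ hF _ (hT σ) P⟩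

/-- **The obstruction values are constants**: for functions `f_σ` with
`div f_σ = n(σ ⋆ T) - n(T)`, the function `f_σ · ρ_σ(f_τ) / f_{στ}` has divisor
`[n(σ⋆T) - n(T)] + [n((στ)⋆T) - n(σ⋆T)] - [n((στ)⋆T) - n(T)] = 0`, so it is a non-zero constant
`e(σ, τ) ∈ K̄^×` (a function without zeros or poles is constant,
`Literature.NumberTheory.EllipticCurves.exists_eq_algebraMap_of_ord_nonneg`). The `2`-cocycle `e`
is the period–index obstruction of the class of `c` at level `n`: the class `Δ ∈ Br(K)` of
Clark–Sharif §2 (3) / O'Neil, the image of the rational divisor class `n·(T)` under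
`δ : Pic(C_{K̄})^{Γ_K} → Br(K)` in Clark 2006, Prop. 6 (second proof).
[cite: ClarkSharif2010, §2 eq. (3)] [cite: Clark2006Crelle, Prop. 6 (second proof)] -/
theorem exists_obstruction_eq_algebraMap {n : ℤ} (T : WeierstrassCurve.geomPoints W)
    (f : Field.absoluteGaloisGroup K → W.geomFunctionField) (hf0 : ∀ σ, f σ ≠ 0)
    (hford : ∀ σ P, ord (W.baseChange (AlgebraicClosure K)).toAffine P (f σ) =
      (Finsupp.single (σ • T + c.1 σ) n - Finsupp.single T n) P)
    (σ τ : Field.absoluteGaloisGroup K) :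
    ∃ e : AlgebraicClosure K, e ≠ 0 ∧ algebraMap (AlgebraicClosure K) W.geomFunctionField e =
      f σ * W.transAlgHom (-(c.1 σ)) (W.galFunctionField σ (f τ)) / f (σ * τ) := by
  have hρ0 : W.transAlgHom (-(c.1 σ)) (W.galFunctionField σ (f τ)) ≠ 0 :=
    ((twistGal_injective W c σ).ne_iff' (by simp only [map_zero])).mpr (hf0 τ)
  set u : W.geomFunctionField :=
    f σ * W.transAlgHom (-(c.1 σ)) (W.galFunctionField σ (f τ)) / f (σ * τ) with hu
  have hu0 : u ≠ 0 := div_ne_zero (mul_ne_zero (hf0 σ) hρ0) (hf0 (σ * τ))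
  -- `div (ρ_σ f_τ) = n((στ) ⋆ T) - n(σ ⋆ T)`
  have hordρ : ∀ P, ord (W.baseChange (AlgebraicClosure K)).toAffine P
      (W.transAlgHom (-(c.1 σ)) (W.galFunctionField σ (f τ))) =
        (Finsupp.single ((σ * τ) • T + c.1 (σ * τ)) n - Finsupp.single (σ • T + c.1 σ) n) P := by
    intro P
    rw [ord_twistGal', hford τ]
    simp only [Finsupp.sub_apply, Finsupp.single_apply, eq_inv_smul_iff, eq_sub_iff_add_eq,
      twist_mul W c]
  have huord : ∀ P, ord (W.baseChange (AlgebraicClosure K)).toAffine P u = 0 := by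
    intro P
    rw [hu, ord_div P (mul_ne_zero (hf0 σ) hρ0) (hf0 (σ * τ)), ord_mul P (hf0 σ) hρ0, hford σ,
      hordρ, hford (σ * τ)]
    simp only [Finsupp.sub_apply]
    ring
  obtain ⟨e, he⟩ := exists_eq_algebraMap_of_ord_nonneg (W := W) (u := u) fun P ↦ (huord P).ge
  refine ⟨e, fun h0 ↦ hu0 ?_, he⟩
  rw [← he, h0, map_zero]

/-- **A rational divisor class whose obstruction vanishes contains a rational divisor.** Let
`K` be perfect, `c : Γ_K → E(K̄)` a continuous crossed homomorphism, `T ∈ E(K̄)` with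
`n(σ ⋆ T - T) = O` for all `σ` (a rational divisor class `n·(T)` of degree `n` on the torsor
`C_c`), `f_σ` locally constant functions with `div f_σ = n(σ ⋆ T) - n(T)`, and suppose the
obstruction `2`-cocycle `e(σ,τ) = f_σ ρ_σ(f_τ)/f_{στ} ∈ K̄^×` is the coboundary of a locally
constant `b : Γ_K → K̄^×`: `e(σ,τ) = b(σ) σ(b(τ)) b(στ)⁻¹`. Then `C_c` carries a `K`-rational
divisor of degree `n`, i.e. there is `D : E(K̄) →₀ ℤ` of degree `n` invariant under
`σ ⋆ Q = σ Q + c(σ)`. Proof (Clark 2006, Prop. 6, second proof: exactness of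
`0 → Pic(C) → Pic(C_{K̄})^{Γ_K} → Br(K)` at the middle term, made explicit):
`f'_σ = f_σ / b(σ)` is a `1`-cocycle for the twisted action on `K̄(E)^×`, so `f'_σ = ρ_σ(g)/g`
by Hilbert 90 (`exists_eq_twistGal_div`), and `D = n(T) - div g` is invariant:
`div ρ_σ(g) = σ ⋆ div g` (`ord_twistGal`) and `div ρ_σ(g) = div f_σ + div g =
n(σ⋆T) - n(T) + div g`. [cite: Clark2006Crelle, Prop. 6 (second proof)]
[cite: ClarkSharif2010, §2 eq. (3)] -/
theorem exists_twistInvariant_divisor_of_coboundary [PerfectField K] {n : ℤ}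
    (T : WeierstrassCurve.geomPoints W)
    (f : Field.absoluteGaloisGroup K → W.geomFunctionField) (hfc : IsLocallyConstant f)
    (hf0 : ∀ σ, f σ ≠ 0)
    (hford : ∀ σ P, ord (W.baseChange (AlgebraicClosure K)).toAffine P (f σ) =
      (Finsupp.single (σ • T + c.1 σ) n - Finsupp.single T n) P)
    (b : Field.absoluteGaloisGroup K → AlgebraicClosure K) (hbc : IsLocallyConstant b)
    (hb0 : ∀ σ, b σ ≠ 0)
    (hcob : ∀ σ τ, f σ * W.transAlgHom (-(c.1 σ)) (W.galFunctionField σ (f τ)) / f (σ * τ) =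
      algebraMap (AlgebraicClosure K) W.geomFunctionField (b σ * σ • b τ / b (σ * τ))) :
    ∃ D : WeierstrassCurve.geomPoints W →₀ ℤ, (D.sum fun _ m ↦ m) = n ∧
      ∀ (g : Field.absoluteGaloisGroup K) (Q : WeierstrassCurve.geomPoints W),
        D (g • Q + c.1 g) = D Q := by
  -- notation
  set ρ : Field.absoluteGaloisGroup K → W.geomFunctionField →+* W.geomFunctionField :=
    fun σ ↦ (W.transAlgHom (-(c.1 σ))).toRingHom.comp (W.galFunctionField σ).toRingHom with hρ
  have hρapply : ∀ σ z, ρ σ z = W.transAlgHom (-(c.1 σ)) (W.galFunctionField σ z) :=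
    fun _ _ ↦ rfl
  have hρconst : ∀ (σ : Field.absoluteGaloisGroup K) (x : AlgebraicClosure K),
      ρ σ (algebraMap (AlgebraicClosure K) W.geomFunctionField x) =
        algebraMap (AlgebraicClosure K) W.geomFunctionField (σ • x) :=
    fun σ x ↦ twistGal_algebraMap W c σ x
  set B : Field.absoluteGaloisGroup K → W.geomFunctionField :=
    fun σ ↦ algebraMap (AlgebraicClosure K) W.geomFunctionField (b σ) with hB
  have hB0 : ∀ σ, B σ ≠ 0 := fun σ ↦ by
    rw [hB]
    exact (map_ne_zero _).mpr (hb0 σ)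
  have hcob' : ∀ σ τ, f σ * ρ σ (f τ) = f (σ * τ) * (B σ * ρ σ (B τ) / B (σ * τ)) := by
    intro σ τ
    have h := hcob σ τ
    rw [← hρapply, div_eq_iff (hf0 (σ * τ))] at h
    rw [h, hB]
    simp only [map_mul, map_div₀, hρconst]
    ring
  -- the `1`-cocycle `f'_σ = f_σ / b(σ)` for the twisted action
  set f' : Field.absoluteGaloisGroup K → W.geomFunctionField := fun σ ↦ f σ / B σ with hf'
  have hf'0 : ∀ σ, f' σ ≠ 0 := fun σ ↦ div_ne_zero (hf0 σ) (hB0 σ)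
  have hf'c : IsLocallyConstant f' :=
    hfc.comp₂ (hbc.comp (algebraMap (AlgebraicClosure K) W.geomFunctionField)) fun x y ↦ x / y
  have hf'coc : ∀ σ τ, f' (σ * τ) = f' σ * ρ σ (f' τ) := by
    intro σ τ
    have hρB : ρ σ (B τ) ≠ 0 := (map_ne_zero (ρ σ)).mpr (hB0 τ)
    have h1 := hB0 σ
    have h2 := hB0 (σ * τ)
    have h3 := hf0 (σ * τ)
    simp only [hf']
    rw [map_div₀, div_mul_div_comm, hcob' σ τ]
    field_simp
  -- Hilbert 90: `f'_σ = ρ_σ(g) / g`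
  obtain ⟨g, hg0, hg⟩ := exists_eq_twistGal_div W c f' hf'c hf'0 fun σ τ ↦ by
    rw [hf'coc, hρapply]
  -- `div g` and the divisor `D = n(T) - div g`
  have hfin : (Function.support fun P : WeierstrassCurve.geomPoints W ↦
      ord (W.baseChange (AlgebraicClosure K)).toAffine P g).Finite :=
    finite_support_ord (V := (W.baseChange (AlgebraicClosure K)).toAffine) hg0
  set Dg : WeierstrassCurve.geomPoints W →₀ ℤ := Finsupp.ofSupportFinite _ hfin with hDg
  have hDg_apply : ∀ P, Dg P = ord (W.baseChange (AlgebraicClosure K)).toAffine P g := fun P ↦ by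
    rw [hDg, Finsupp.ofSupportFinite_coe]
  have hDg_sum : (Dg.sum fun _ m ↦ m) = 0 := by
    have hsub : (Function.support fun P : WeierstrassCurve.geomPoints W ↦
        ord (W.baseChange (AlgebraicClosure K)).toAffine P g) ⊆
        (Dg.support : Set (WeierstrassCurve.geomPoints W)) := fun P hP ↦
      Finset.mem_coe.mpr (Finsupp.mem_support_iff.mpr (by rw [hDg_apply]; exact hP))
    have h : ∑ᶠ P : WeierstrassCurve.geomPoints W,
        ord (W.baseChange (AlgebraicClosure K)).toAffine P g = 0 :=
      finsum_ord (V := (W.baseChange (AlgebraicClosure K)).toAffine) hg0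
    rw [finsum_eq_sum_of_support_subset _ hsub] at h
    simp only [Finsupp.sum, hDg_apply]
    exact h
  refine ⟨Finsupp.single T n - Dg, ?_, fun σ Q ↦ ?_⟩
  · rw [Finsupp.sum_sub_index (fun _ _ _ ↦ rfl), Finsupp.sum_single_index rfl, hDg_sum, sub_zero]
  · -- `ord_{σ⋆Q} (ρ_σ g) = ord_Q (g)` and `ρ_σ g = f'_σ g`, `div f'_σ = n(σ⋆T) - n(T)`
    have hρg : ρ σ g = f' σ * g := by
      rw [hg σ, hρapply, div_mul_cancel₀ _ hg0]
    have h1 : ord (W.baseChange (AlgebraicClosure K)).toAffine (σ • Q + c.1 σ) (ρ σ g) =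
        ord (W.baseChange (AlgebraicClosure K)).toAffine Q g := by
      rw [hρapply, ord_twistGal]
    have h2 : ord (W.baseChange (AlgebraicClosure K)).toAffine (σ • Q + c.1 σ) (ρ σ g) =
        ord (W.baseChange (AlgebraicClosure K)).toAffine (σ • Q + c.1 σ) (f σ) +
          ord (W.baseChange (AlgebraicClosure K)).toAffine (σ • Q + c.1 σ) g := by
      rw [hρg, ord_mul _ (hf'0 σ) hg0]
      congr 1
      simp only [hf']
      rw [ord_div _ (hf0 σ) (hB0 σ), hB]
      simp only [ord_algebraMap, sub_zero]
    rw [hford σ] at h2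
    simp only [Finsupp.sub_apply, Finsupp.single_apply, add_left_inj, smul_left_cancel_iff] at h2
    simp only [Finsupp.sub_apply, Finsupp.single_apply, hDg_apply]
    linarith

/-- **Vanishing obstruction bounds the index: `I([c]) ∣ n`.** Under the hypotheses of
`exists_twistInvariant_divisor_of_coboundary` (a rational divisor class `n·(T)` on the torsor
whose obstruction `2`-cocycle is a continuous coboundary in `K̄^×`), the index of the class of
`c` divides `n` (`index_dvd_degree_of_twistInvariant`). This is property (a), direction ⇐, of
O'Neil's period–index obstruction — "`C` has a rational divisor of degree `n`, so `I ∣ n`"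
(Clark 2006, Prop. 6). [cite: Clark2006Crelle, Prop. 6] [cite: ClarkSharif2010, §2 eq. (3)] -/
theorem index_dvd_of_obstruction_coboundary [PerfectField K] {n : ℕ}
    (T : WeierstrassCurve.geomPoints W)
    (f : Field.absoluteGaloisGroup K → W.geomFunctionField) (hfc : IsLocallyConstant f)
    (hf0 : ∀ σ, f σ ≠ 0)
    (hford : ∀ σ P, ord (W.baseChange (AlgebraicClosure K)).toAffine P (f σ) =
      (Finsupp.single (σ • T + c.1 σ) (n : ℤ) - Finsupp.single T (n : ℤ)) P)
    (b : Field.absoluteGaloisGroup K → AlgebraicClosure K) (hbc : IsLocallyConstant b)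
    (hb0 : ∀ σ, b σ ≠ 0)
    (hcob : ∀ σ τ, f σ * W.transAlgHom (-(c.1 σ)) (W.galFunctionField σ (f τ)) / f (σ * τ) =
      algebraMap (AlgebraicClosure K) W.geomFunctionField (b σ * σ • b τ / b (σ * τ))) :
    index W (oneCocycleClass _ c) ∣ n := by
  obtain ⟨D, hdeg, hD⟩ :=
    exists_twistInvariant_divisor_of_coboundary W c T f hfc hf0 hford b hbc hb0 hcob
  have h := index_dvd_degree_of_twistInvariant W c D hD
  rw [hdeg] at h
  exact Int.natCast_dvd_natCast.mp h

end Obstruction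

/-! ### Cassels' theorem from the vanishing of the obstruction on Selmer classes -/

section Assembly

/-- **Cassels' `I = P` on `Ш` from the vanishing of the period–index obstruction of Selmer
classes.** The named fact `Literature.NumberTheory.EllipticCurves.Cassels1962_index_eq_period_of_mem_sha`
follows from: *for every elliptic curve `E` over a number field `K`, every prime power
`n = p^a`, every `ξ ∈ Sel^(n)(E/K)`, every cocycle `c` representing the image of `ξ` in
`H¹(K, E)`, every rational divisor class `n·(T)` on the torsor (`n(σ ⋆ T - T) = O`) and every
locally constant choice of functions `f_σ` with `div f_σ = n(σ⋆T) - n(T)`, the obstruction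
`2`-cocycle `e(σ, τ) = f_σ ρ_σ(f_τ)/f_{στ} ∈ K̄^×` is the coboundary of a locally constant
cochain `b : Γ_K → K̄^×`.* For then `I(ι ξ) ∣ n` (`index_dvd_of_obstruction_coboundary`, with
`exists_zsmul_twist_sub_eq_zero` and `exists_fn_ord_eq_twist` providing `T` and `f`), which is
the Selmer form of Cassels' theorem at prime-power level
(`Literature.NumberTheory.EllipticCurves.Cassels1962_index_eq_period_of_mem_sha_of_selmer_isPrimePow`).
The hypothesis is what both printed proofs establish for locally trivial classes: the
obstruction `Δ = δ(n·(T)) ∈ Br(K)[n]` is locally trivial at every place (a local point on the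
torsor gives a local rational divisor in the class) and hence trivial "by virtue of the
reciprocity law in the Brauer group of a number field" (Clark 2006, Prop. 6; the exactness of
`0 → Br(K) → ⊕_v Br(K_v)`, Albert–Brauer–Hasse–Noether). It is spelled out as a hypothesis, not
vendored as a named fact (D-0026). [cite: Clark2006Crelle, Prop. 6 with Prop. 5(a)]
[cite: ClarkSharif2010, §2 eq. (3) and §3.7 (ii)] -/
theorem Cassels1962_index_eq_period_of_mem_sha_of_obstruction
    (h : ∀ {K : Type u} [Field K] [NumberField K] (W : WeierstrassCurve K) [W.IsElliptic] {n : ℕ},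
      IsPrimePow n → ∀ ξ ∈ W.selmerGroup n,
      ∀ (c : contOneCocycles (discreteTopRep (Field.absoluteGaloisGroup K) (WeierstrassCurve.geomPoints W)))
        (T : WeierstrassCurve.geomPoints W) (f : Field.absoluteGaloisGroup K → W.geomFunctionField),
        oneCocycleClass _ c = W.torsionH1ToH1 n ξ →
        (∀ σ : Field.absoluteGaloisGroup K, (n : ℤ) • (σ • T + c.1 σ - T) = 0) →
        IsLocallyConstant f → (∀ σ, f σ ≠ 0) →
        (∀ σ P, ord (W.baseChange (AlgebraicClosure K)).toAffine P (f σ) =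
          (Finsupp.single (σ • T + c.1 σ) (n : ℤ) - Finsupp.single T (n : ℤ)) P) →
        ∃ b : Field.absoluteGaloisGroup K → AlgebraicClosure K, IsLocallyConstant b ∧
          (∀ σ, b σ ≠ 0) ∧
          ∀ σ τ, f σ * W.transAlgHom (-(c.1 σ)) (W.galFunctionField σ (f τ)) / f (σ * τ) =
            algebraMap (AlgebraicClosure K) W.geomFunctionField (b σ * σ • b τ / b (σ * τ))) :
    Cassels1962_index_eq_period_of_mem_sha.{u} := by
  refine Cassels1962_index_eq_period_of_mem_sha_of_selmer_isPrimePow fun W _ n hn ξ hξ ↦ ?_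
  obtain ⟨c, hc⟩ := oneCocycleClass_surjective
    (discreteTopRep (Field.absoluteGaloisGroup _) (WeierstrassCurve.geomPoints W)) (W.torsionH1ToH1 n ξ)
  have hn0 : (n : ℤ) ≠ 0 := by exact_mod_cast hn.pos.ne'
  have hnc : (n : ℤ) • oneCocycleClass _ c = 0 := by
    rw [hc]
    exact WeierstrassCurve.torsionH1ToH1_mem_torsionBy W n ξ
  obtain ⟨T, hT⟩ := exists_zsmul_twist_sub_eq_zero W c hn0 hnc
  obtain ⟨f, hfc, hf0, hford⟩ := exists_fn_ord_eq_twist W c T hT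
  obtain ⟨b, hbc, hb0, hcob⟩ := h W hn ξ hξ c T f hc hT hfc hf0 hford
  rw [← hc]
  exact index_dvd_of_obstruction_coboundary W c T f hfc hf0 hford b hbc hb0 hcob

end Assembly

end Literature.NumberTheory.EllipticCurves
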